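import Mathlib
import Summits.ResolutionOfSingularities.ResolutionOfSingularities.Theorems.WeightedInvariantLocalWeightedDropPureDescentShearBeta
import Summits.ResolutionOfSingularities.ResolutionOfSingularities.Theorems.WeightedInvariantLocalWeightedDropMonicDescentTailPointStep
import Summits.ResolutionOfSingularities.ResolutionOfSingularities.Theorems.WeightedInvariantLocalWeightedDropMonicDescentChartSubst

/-!
# `WeightedInvariant.LocalWeightedDrop`, stub S3πM: the pure-power polyhedron descent — NO INFINITE Σ**_q-CHAIN (piece P-T = T-5′_q; CJS Thm 13.7 / Claim 13.8)

Crux item stmt-ResolutionOfSingularities-8899 `LocalWeightedDrop` (route `ResolutionOfSingularities/WeightedInvariant`), registered skeleton v29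
(4058ce51dfd2e5c8), stub S3πM `stub_wildPurelyInseparableReductionWon`.  [OURS · L1 W4.3, chain w43, lead prover (gen 3); a LINE UNDER THE STUB: the
pure-power polyhedron descent (second key to S3πM), MODEL Cossart–Jannsen–Saito LNM 2270 Ch. 11–13 for `J = (y^q + A)`, `e = 2`, `k = k̄` — the
degree-2 instance is the landed key N4″ (`…Theorems.MonicDescent*`); nothing here is a statement of any manuscript.]

Along a β-neutral chain (all steps `V(y,u₁)`-blow-ups or point moves answered by `(1:0)`/`(1:λ)`): point steps vs curve steps, the parameters `λ_m`,
infinitely many point steps (`α` drops by `q` at each curve step), the index `ptIdx` of the `i`-th point step, the LIMIT SHEAR `hser m` (coefficient of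
`u₁^i` = parameter of the `i`-th point step after `m`) with `hser m = C λ_m + u₁ · hser (m+1)` / `hser (m+1) = hser m`; the STRAIGHTENED CLEANED LABELS
`Â m = clean q ((A m)(u₁, u₂ + u₁·hser m))`: clean positions, non-empty, same `α`; ONE-STEP LAWS `Â (m+1) = blowOne q (Â m)` at a point step (shears add,
re-centrings die under cleaning, cleaning commutes with the chart — `q = p^e`, perfect field) and `Â (m+1) = Â m / u₁^q` at a curve step; `ε(Â m) < q`
(else a GRAPH CURVE at a point step, excluded by neutrality); so `ζ(Â m)` drops at every step: `noChain` — there is no infinite Σ**_q-chain of clean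
non-zero positions.  The degree-2 instance is `MonicDescent.monicDescentNoChain` (p493102); here the preparation hypothesis T-1′ is not needed (cleaning
is canonical).
-/

set_option linter.dupNamespace false -- mandated namespace of this single-conjunct summit

noncomputable section

namespace Summit.ResolutionOfSingularities.ResolutionOfSingularities.Theorems

namespace PureDescent

open MvPowerSeries MonicDescent Literature.RingTheory.TwoVariableSeries Literature.AlgebraicGeometry.Resolution

attribute [local instance] Classical.propDecidable

variable {k : Type} [Field k]

section Tail

variable (q : ℕ) (A : ℕ → MvPowerSeries (Fin 2) k)
  (hA : ∀ m, IsClean q (A m) ∧ IsPosition q (A m) ∧ A m ≠ 0 ∧ IsNeutralStep q (A m) (A (m + 1)))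

/-- A POINT STEP of the neutral chain: `V(y,u₁)` is not permissible at `A m`. -/
def IsPointStep (m : ℕ) : Prop := ¬ IsPermissibleOne q (A m)

include hA in
/-- At a curve step the next label is `A m / u₁^q`. -/
theorem succ_eq_divOne {m : ℕ} (hm : ¬ IsPointStep q A m) : A (m + 1) = divOne q (A m) := by
  unfold IsPointStep at hm
  push Not at hm
  rcases (hA m).2.2.2 with ⟨-, h⟩ | ⟨h1, -⟩
  · exact h
  · exact absurd hm h1

include hA in
/-- At a point step: no axis curve, no graph curve, and the next label is `blowOne q (A m)` or `blowOne q (clean q (shear (C c) (A m)))`, `c ≠ 0`. -/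
theorem pointStep_cases {m : ℕ} (hm : IsPointStep q A m) :
    ¬ IsPermissibleOne q (A m) ∧ ¬ IsPermissibleTwo q (A m) ∧ ¬ HasGraphCurve q (A m) ∧
      ∃ c : k, (c = 0 ∧ A (m + 1) = blowOne q (A m)) ∨ (c ≠ 0 ∧ A (m + 1) = blowOne q (clean q (shear (C c) (A m)))) := by
  rcases (hA m).2.2.2 with ⟨h1, -⟩ | ⟨h1, h2, h3, h⟩
  · exact absurd h1 hm
  · refine ⟨h1, h2, h3, ?_⟩
    rcases h with h | ⟨c, hc, h⟩
    · exact ⟨0, Or.inl ⟨rfl, h⟩⟩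
    · exact ⟨c, Or.inr ⟨hc, h⟩⟩

/-- The PARAMETER `λ_m` of step `m`: the `c` of a `(1:c)` point step, `0` otherwise. -/
noncomputable def param (m : ℕ) : k :=
  if h : IsPointStep q A m ∧ ∃ c : k, c ≠ 0 ∧ A (m + 1) = blowOne q (clean q (shear (C c) (A m))) then Classical.choose h.2 else 0

include hA in
/-- UNIFIED POINT-STEP SHAPE: at a point step `A (m+1) = blowOne q (clean q (shear (C λ_m) (A m)))` (for `λ_m = 0` the shear is trivial and
`A m` is already clean). -/
theorem pointStep_eq {m : ℕ} (hm : IsPointStep q A m) :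
    A (m + 1) = blowOne q (clean q (shear (C (param q A m)) (A m))) := by
  obtain ⟨-, -, -, c, hc⟩ := pointStep_cases q A hA hm
  by_cases hex' : ∃ c : k, c ≠ 0 ∧ A (m + 1) = blowOne q (clean q (shear (C c) (A m)))
  · have hparam : param q A m = Classical.choose hex' := by
      unfold param; rw [dif_pos ⟨hm, hex'⟩]
    rw [hparam]
    exact (Classical.choose_spec hex').2
  · have hparam : param q A m = 0 := by
      unfold param; rw [dif_neg (fun h => hex' h.2)]
    rcases hc with ⟨-, hAeq⟩ | ⟨hcne, hAeq⟩
    · rw [hAeq, hparam, map_zero, shear_zero_eq, clean_eq_self_of_isClean (hA m).1]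
    · exact absurd ⟨c, hcne, hAeq⟩ hex'

include hA in
/-- `α` drops by exactly `q` at a curve step. -/
theorem alphaL_succ_of_not_isPointStep {m : ℕ} (hm : ¬ IsPointStep q A m) :
    alphaL (nset (A (m + 1))) + q = alphaL (nset (A m)) := by
  have hP1 : IsPermissibleOne q (A m) := by unfold IsPointStep at hm; push Not at hm; exact hm
  have hne := (nset_nonempty_iff _).mpr (hA m).2.2.1
  rw [succ_eq_divOne q A hA hm, nset_divOne q (A m) hP1, alphaL_image_shift_add (shiftOneQ_fst hP1) hne]

include hA in
/-- INFINITELY MANY POINT STEPS (`q > 0`): a run of curve steps lowers `α` by `q` each time. -/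
theorem exists_isPointStep_ge (hq : 0 < q) (m : ℕ) : ∃ n, m ≤ n ∧ IsPointStep q A n := by
  by_contra h
  push Not at h
  have hdec : ∀ j, alphaL (nset (A (m + j))) + q * j = alphaL (nset (A m)) := by
    intro j
    induction j with
    | zero => simp
    | succ j ih =>
      have hstep := alphaL_succ_of_not_isPointStep q A hA (h (m + j) (by omega))
      rw [show m + (j + 1) = m + j + 1 from by omega, Nat.mul_succ]
      omega
  have := hdec (alphaL (nset (A m)) + 1)
  have h1 : alphaL (nset (A m)) + 1 ≤ q * (alphaL (nset (A m)) + 1) := Nat.le_mul_of_pos_left _ hq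
  omega

/-- The index of the `i`-th point step at or after `m`. -/
noncomputable def ptIdx (m : ℕ) (hex : ∀ m, ∃ n, m ≤ n ∧ IsPointStep q A n) : ℕ → ℕ
  | 0 => Nat.find (hex m)
  | i + 1 => Nat.find (hex (ptIdx m hex i + 1))

section PtIdx

variable (hex : ∀ m, ∃ n, m ≤ n ∧ IsPointStep q A n)

/-- `ptIdx m 0` is a point step `≥ m`, and the least such. -/
theorem ptIdx_zero_spec (m : ℕ) : m ≤ ptIdx q A m hex 0 ∧ IsPointStep q A (ptIdx q A m hex 0) ∧
    ∀ n, m ≤ n → IsPointStep q A n → ptIdx q A m hex 0 ≤ n := by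
  refine ⟨(Nat.find_spec (hex m)).1, (Nat.find_spec (hex m)).2, fun n hmn hn => ?_⟩
  exact Nat.find_min' (hex m) ⟨hmn, hn⟩

/-- At a point step `m`: the `0`-th point step after `m` is `m` itself. -/
theorem ptIdx_zero_of_isPointStep {m : ℕ} (hm : IsPointStep q A m) : ptIdx q A m hex 0 = m :=
  le_antisymm ((ptIdx_zero_spec q A hex m).2.2 m le_rfl hm) (ptIdx_zero_spec q A hex m).1

/-- At a curve step `m`: the point steps after `m` are those after `m + 1`. -/
theorem ptIdx_zero_of_not_isPointStep {m : ℕ} (hm : ¬ IsPointStep q A m) : ptIdx q A m hex 0 = ptIdx q A (m + 1) hex 0 := by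
  apply le_antisymm
  · exact (ptIdx_zero_spec q A hex m).2.2 _ (by have := (ptIdx_zero_spec q A hex (m + 1)).1; omega)
      (ptIdx_zero_spec q A hex (m + 1)).2.1
  · refine (ptIdx_zero_spec q A hex (m + 1)).2.2 _ ?_ (ptIdx_zero_spec q A hex m).2.1
    have h1 := (ptIdx_zero_spec q A hex m).1
    rcases Nat.eq_or_lt_of_le h1 with h | h
    · exact absurd (h ▸ (ptIdx_zero_spec q A hex m).2.1) hm
    · omega

/-- Shift of the point-step index at a point step. -/
theorem ptIdx_succ_of_isPointStep {m : ℕ} (hm : IsPointStep q A m) (i : ℕ) : ptIdx q A m hex (i + 1) = ptIdx q A (m + 1) hex i := by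
  induction i with
  | zero =>
    show Nat.find (hex (ptIdx q A m hex 0 + 1)) = ptIdx q A (m + 1) hex 0
    rw [ptIdx_zero_of_isPointStep q A hex hm]
    rfl
  | succ i ih =>
    show Nat.find (hex (ptIdx q A m hex (i + 1) + 1)) = Nat.find (hex (ptIdx q A (m + 1) hex i + 1))
    rw [ih]

/-- Shift of the point-step index at a curve step. -/
theorem ptIdx_of_not_isPointStep {m : ℕ} (hm : ¬ IsPointStep q A m) (i : ℕ) : ptIdx q A m hex i = ptIdx q A (m + 1) hex i := by
  induction i with
  | zero => exact ptIdx_zero_of_not_isPointStep q A hex hm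
  | succ i ih =>
    show Nat.find (hex (ptIdx q A m hex i + 1)) = Nat.find (hex (ptIdx q A (m + 1) hex i + 1))
    rw [ih]

/-- THE LIMIT SHEAR at time `m`: the series in `u₁` whose coefficient of `u₁^i` is the parameter of the `i`-th point step after `m`
(CJS Claim 13.8's `v = u₂ + Σ λ_j u₁^{j+1}`, read from time `m` on). -/
noncomputable def hser (m : ℕ) : MvPowerSeries (Fin 2) k :=
  fun e => if e 1 = 0 then param q A (ptIdx q A m hex (e 0)) else 0

/-- Coefficients of the limit shear. -/
theorem coeff_hser (m : ℕ) (e : Fin 2 →₀ ℕ) :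
    coeff e (hser q A hex m) = if e 1 = 0 then param q A (ptIdx q A m hex (e 0)) else 0 := rfl

/-- The limit shear is a series in `u₁` only. -/
theorem hser_noY (m : ℕ) : ∀ e : Fin 2 →₀ ℕ, e 1 ≠ 0 → coeff e (hser q A hex m) = 0 := by
  intro e he
  rw [coeff_hser, if_neg he]

/-- POINT-STEP RELATION: `hser m = C (λ m) + u₁ · hser (m+1)`. -/
theorem hser_of_isPointStep {m : ℕ} (hm : IsPointStep q A m) : hser q A hex m = C (param q A m) + X 0 * hser q A hex (m + 1) := by
  ext e
  rw [coeff_hser, map_add, coeff_C, show (X 0 : MvPowerSeries (Fin 2) k) = monomial (Finsupp.single 0 1) 1 from X_def 0,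
    coeff_monomial_mul]
  by_cases he1 : e 1 = 0
  · rw [if_pos he1]
    by_cases he0 : e 0 = 0
    · have he : e = 0 := finsupp_fin2_ext (by simpa using he0) (by simpa using he1)
      subst he
      simp only [Finsupp.coe_zero, Pi.zero_apply, ptIdx_zero_of_isPointStep q A hex hm, if_true]
      rw [if_neg (by intro h; have := h 0; simp at this), add_zero]
    · rw [if_neg (by intro h; exact he0 (by rw [h]; rfl)), zero_add, if_pos (by intro i; fin_cases i <;> simp; omega), one_mul,
        coeff_hser, if_pos (by simpa using he1)]
      have : (e - Finsupp.single 0 1 : Fin 2 →₀ ℕ) 0 = e 0 - 1 := by simp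
      rw [this]
      obtain ⟨j, hj⟩ : ∃ j, e 0 = j + 1 := ⟨e 0 - 1, by omega⟩
      rw [hj, ptIdx_succ_of_isPointStep q A hex hm j]
      simp
  · rw [if_neg he1, if_neg (by intro h; apply he1; rw [h]; rfl), zero_add]
    split_ifs with hle
    · rw [coeff_hser, if_neg (by simpa using he1), mul_zero]
    · rfl

/-- CURVE-STEP RELATION: `hser (m+1) = hser m`. -/
theorem hser_of_not_isPointStep {m : ℕ} (hm : ¬ IsPointStep q A m) : hser q A hex (m + 1) = hser q A hex m := by
  ext e
  rw [coeff_hser, coeff_hser]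
  split_ifs
  · rw [ptIdx_of_not_isPointStep q A hex hm]
  · rfl

/-! ### The straightened cleaned labels `Â m = clean (A m)(u₁, u₂ + u₁·hser m)` -/

/-- The STRAIGHTENED label `S m = (A m)(u₁, u₂ + u₁·hser m)`. -/
noncomputable def Slab (m : ℕ) : MvPowerSeries (Fin 2) k := shear (hser q A hex m) (A m)

/-- The CLEANED STRAIGHTENED label `Â m = clean q (S m)`. -/
noncomputable def Ahat (m : ℕ) : MvPowerSeries (Fin 2) k := clean q (Slab q A hex m)

include hA in
/-- `Â m` is a clean position with non-empty support and the same `α` as `A m`. -/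
theorem Ahat_spec (m : ℕ) :
    IsClean q (Ahat q A hex m) ∧ IsPosition q (Ahat q A hex m) ∧ (nset (Ahat q A hex m)).Nonempty ∧
      alphaL (nset (Ahat q A hex m)) = alphaL (nset (A m)) := by
  obtain ⟨hcl, hpos, hne, -⟩ := hA m
  obtain ⟨hneS, hαS, -⟩ := clean_shear_spec (hser q A hex m) hcl ((nset_nonempty_iff _).mpr hne)
  exact ⟨isClean_clean q _, isPosition_clean (isPosition_shear _ hpos), hneS, hαS⟩

include hA in
/-- CURVE-STEP LAW: `Â (m+1) = Â m / u₁^q`. -/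
theorem Ahat_succ_of_not_isPointStep {m : ℕ} (hm : ¬ IsPointStep q A m) :
    Ahat q A hex (m + 1) = divOne q (Ahat q A hex m) := by
  have hP1 : IsPermissibleOne q (A m) := by unfold IsPointStep at hm; push Not at hm; exact hm
  unfold Ahat Slab
  rw [hser_of_not_isPointStep q A hex hm, succ_eq_divOne q A hA hm, ← divOne_shear q _ _ hP1, clean_divOne]

end PtIdx

end Tail

section TailFrob

variable (p : ℕ) (hp : p.Prime) [CharP k p] [PerfectRing k p] (e : ℕ) (A : ℕ → MvPowerSeries (Fin 2) k)
  (hA : ∀ m, IsClean (p ^ e) (A m) ∧ IsPosition (p ^ e) (A m) ∧ A m ≠ 0 ∧ IsNeutralStep (p ^ e) (A m) (A (m + 1)))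
  (hex : ∀ m, ∃ n, m ≤ n ∧ IsPointStep (p ^ e) A n)

include hp hA in
/-- POINT-STEP LAW (`q = p^e`, perfect field): `Â (m+1) = blowOne q (Â m)` — the shears add up in the limit coordinate, re-centrings die under
cleaning, and cleaning commutes with the chart (CJS Claim 13.8 in the cleaned form). -/
theorem Ahat_succ_of_isPointStep {m : ℕ} (hm : IsPointStep (p ^ e) A m) :
    Ahat (p ^ e) A hex (m + 1) = blowOne (p ^ e) (Ahat (p ^ e) A hex m) := by
  set q := p ^ e with hq
  set c := param q A m with hc
  set h' := hser q A hex (m + 1) with hh'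
  have hrel : hser q A hex m = C c + X 0 * h' := hser_of_isPointStep q A hex hm
  have hstep : A (m + 1) = blowOne q (clean q (shear (C c) (A m))) := pointStep_eq q A hA hm
  obtain ⟨hcl, hpos, hne, -⟩ := hA m
  have hA0 : constantCoeff (A m) = 0 := by
    have h0 : coeff (0 : Fin 2 →₀ ℕ) (A m) = 0 := coeff_of_lt_order (lt_of_le_of_lt (by simp) hpos)
    simpa using h0
  -- the inner cleaned label `Q` is a position, so `blowOne` commutes with the outer shear
  set Q := clean q (shear (C c) (A m)) with hQ
  have hQpos : IsPosition q Q := isPosition_clean (isPosition_shear (C c) hpos)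
  have hQsum : ∀ d : Fin 2 →₀ ℕ, coeff d Q ≠ 0 → q ≤ d 0 + d 1 := fun d hd => le_sum_of_isPosition hQpos d hd
  unfold Ahat Slab
  rw [hstep, ← hh', ← blowOne_shear q h' Q (hser_noY q A hex (m + 1)) hQsum, clean_blowOne, hQ,
    clean_shear_clean_shear p hp e (X 0 * h') (C c) (A m) (fun d hd => by
      rw [coeff_C, if_neg]; rintro rfl; exact hd rfl) hA0,
    hrel, add_comm]

omit [CharP k p] [PerfectRing k p] in
include hA in
/-- At a curve step `Â m` is permissible for `V(y,u₁)` as well (same `α` as `A m`). -/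
theorem isPermissibleOne_Ahat_of_not_isPointStep {m : ℕ} (hm : ¬ IsPointStep (p ^ e) A m) :
    IsPermissibleOne (p ^ e) (Ahat (p ^ e) A hex m) := by
  have hP1 : IsPermissibleOne (p ^ e) (A m) := by unfold IsPointStep at hm; push Not at hm; exact hm
  apply isPermissibleOne_of_le_alphaL
  rw [(Ahat_spec (p ^ e) A hA hex m).2.2.2]
  obtain ⟨P, hP, hP0⟩ := exists_eq_alphaL ((nset_nonempty_iff _).mpr (hA m).2.2.1)
  rw [← hP0]; exact hP1 P hP

omit [CharP k p] [PerfectRing k p] in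
include hA in
/-- At a point step `ε(Â m) < q`: otherwise `V(y, ũ₂)` would be permissible for the cleaned sheared label, i.e. `A m` would have a GRAPH CURVE
(`h = hser m`), which β-neutrality excludes at point steps. -/
theorem epsL_Ahat_lt_of_isPointStep {m : ℕ} (hm : IsPointStep (p ^ e) A m) : epsL (nset (Ahat (p ^ e) A hex m)) < p ^ e := by
  by_contra hge
  push Not at hge
  have hperm : IsPermissibleTwo (p ^ e) (Ahat (p ^ e) A hex m) := isPermissibleTwo_of_le_epsL hge
  exact (pointStep_cases (p ^ e) A hA hm).2.2.1 ⟨hser (p ^ e) A hex m, hser_noY (p ^ e) A hex m, hperm⟩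

omit [CharP k p] [PerfectRing k p] in
include hA in
/-- `ε(Â m) < q` for every `m` (curve steps keep `ε`; reduce to the next point step). -/
theorem epsL_Ahat_lt (m : ℕ) : epsL (nset (Ahat (p ^ e) A hex m)) < p ^ e := by
  obtain ⟨n, hmn, hn⟩ := hex m
  obtain ⟨j, rfl⟩ : ∃ j, n = m + j := ⟨n - m, by omega⟩
  induction j generalizing m with
  | zero => exact epsL_Ahat_lt_of_isPointStep p e A hA hex (by simpa using hn)
  | succ j ih =>
    by_cases hm : IsPointStep (p ^ e) A m
    · exact epsL_Ahat_lt_of_isPointStep p e A hA hex hm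
    · have hε : epsL (nset (Ahat (p ^ e) A hex (m + 1))) = epsL (nset (Ahat (p ^ e) A hex m)) := by
        rw [Ahat_succ_of_not_isPointStep (p ^ e) A hA hex hm,
          nset_divOne (p ^ e) _ (isPermissibleOne_Ahat_of_not_isPointStep p e A hA hex hm),
          epsL_image_shift (shiftOneQ_snd (p ^ e) _) (Ahat_spec (p ^ e) A hA hex m).2.2.1]
      rw [← hε]
      exact ih (m + 1) (by omega) (by rw [show m + 1 + j = m + (j + 1) by omega]; exact hn)

include hp hA in
/-- `ζ` DROPS AT EVERY STEP of the straightened cleaned chain: by `q − ε ≥ 1` at a point step (`ζ′ = ζ + ε − q`), by `q` at a curve step. -/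
theorem zetaL_Ahat_succ_lt (m : ℕ) : zetaL (nset (Ahat (p ^ e) A hex (m + 1))) < zetaL (nset (Ahat (p ^ e) A hex m)) := by
  have hq : 0 < p ^ e := pow_pos hp.pos e
  obtain ⟨-, hpos, hne, -⟩ := Ahat_spec (p ^ e) A hA hex m
  by_cases hm : IsPointStep (p ^ e) A m
  · have hsum := le_sum_of_isPosition hpos
    have hsum1 := succ_le_sum_of_isPosition hpos
    rw [Ahat_succ_of_isPointStep p hp e A hA hex hm, nset_blowOne (p ^ e) _ hsum, zetaL_image_psiC hsum hne]
    have hε := epsL_Ahat_lt p e A hA hex m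
    obtain ⟨P, hP, hP1, hP0⟩ := exists_eq_zetaL hne
    have h := hsum1 P hP
    rw [hP0, hP1] at h
    omega
  · have hP1 := isPermissibleOne_Ahat_of_not_isPointStep p e A hA hex hm
    rw [Ahat_succ_of_not_isPointStep (p ^ e) A hA hex hm, nset_divOne (p ^ e) _ hP1]
    have h := zetaL_image_shift_add (shiftOneQ_fst hP1) (shiftOneQ_snd (p ^ e) _) hne
    omega

include hp hA in
/-- Hence `ζ(Â m) + m ≤ ζ(Â 0)`. -/
theorem zetaL_Ahat_add_le (m : ℕ) : zetaL (nset (Ahat (p ^ e) A hex m)) + m ≤ zetaL (nset (Ahat (p ^ e) A hex 0)) := by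
  induction m with
  | zero => simp
  | succ m ih => have := zetaL_Ahat_succ_lt p hp e A hA hex m; omega

end TailFrob

/-- T-5′_q — NO INFINITE Σ**_q-CHAIN of clean non-zero positions (`q = p^e`, perfect field of characteristic `p`): after β-stabilisation the chain is
β-neutral with infinitely many point steps; straightening by the limit shear and cleaning turns it into an honest chain of `u₁`-charts and
`V(y,u₁)`-blow-ups along which `ζ` drops at every step (CJS Thm 13.7 / Claim 13.8 for `J = (y^q + A)`; degree-2 instance `MonicDescent.monicDescentNoChain`
p493102). -/
theorem noChain (p : ℕ) (hp : p.Prime) (k : Type) [Field k] [CharP k p] [PerfectRing k p] (e : ℕ) :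
    ¬ ∃ A : ℕ → MvPowerSeries (Fin 2) k, ∀ m, IsClean (p ^ e) (A m) ∧ IsPosition (p ^ e) (A m) ∧ A m ≠ 0 ∧ A (m + 1) ∈ succ (p ^ e) (A m) := by
  rintro ⟨A, hA⟩
  have hq : 0 < p ^ e := pow_pos hp.pos e
  obtain ⟨M, hM⟩ := exists_neutral_tail hq A hA
  set B : ℕ → MvPowerSeries (Fin 2) k := fun m => A (M + m) with hB
  have hBA : ∀ m, IsClean (p ^ e) (B m) ∧ IsPosition (p ^ e) (B m) ∧ B m ≠ 0 ∧ IsNeutralStep (p ^ e) (B m) (B (m + 1)) := by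
    intro m
    obtain ⟨hcl, hpos, hne, -⟩ := hA (M + m)
    refine ⟨hcl, hpos, hne, ?_⟩
    have h := (hM (M + m) (by omega)).2
    rw [show M + m + 1 = M + (m + 1) by omega] at h
    exact h
  have hex : ∀ m, ∃ n, m ≤ n ∧ IsPointStep (p ^ e) B n := exists_isPointStep_ge (p ^ e) B hBA hq
  have h := zetaL_Ahat_add_le p hp e B hBA hex (zetaL (nset (Ahat (p ^ e) B hex 0)) + 1)
  omega


end PureDescent

end Summit.ResolutionOfSingularities.ResolutionOfSingularities.Theorems

end
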